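import Summits.NavierStokesRegularity.NavierStokesRegularity.Theorems.TargetDepletionLadderBoundedSharpDepletion
import Literature.Analysis.FluidPDE.ConvolutionCurlCalculus
import Literature.Analysis.FluidPDE.NSWeakStrongUniquenessProofs
import HarnessLib

/-!
# Crux `Target` (stmt-NavierStokesRegularity-1217), line `depletion_ladder`, stub S1 (registered class):
# the MOLLIFIED field of a registered `u` satisfies the sharp depletion inequality with the
# right-hand side OF `u`

`--supports stmt-NavierStokesRegularity-1217` (seat leafhand-ns-poloidalwindowdoor-3 g0, cell decomp-ns; step
(P5) of the registered-class programme for `stub_depletionBelowHalf`, after P1–P4 of this seat).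

For `u` in the registered binders of `StretchingDepletion` (`u ∈ C²`, `div u = 0`, `‖u‖ ≤ M`,
`‖curl u‖² ∈ L¹`, `|∇ curl u|²_F ∈ L¹`) and a bump kernel `φ` (`ρ = φ.normed`, `∫ρ = 1`, `ρ ≥ 0`), the
mollification `u_φ = ρ ⋆ u` is

* `C^∞` (Mathlib `HasCompactSupport.contDiff_convolution_left`), divergence free
  (`divergence_convolution_eq_zero`), bounded by the SAME `M` (`norm_convolution_le_of_norm_le`), with a
  BOUNDED gradient `‖Du_φ‖ ≤ M ∫‖Dρ‖` (`fderiv_convolution_apply_eq`) —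
  `contDiff_mollify`, `isDivFree_mollify`, `norm_mollify_le`, `exists_norm_fderiv_mollify_le`;
* `curl u_φ = ρ ⋆ curl u` (`curl_convolution_lsmul`), so by Jensen `∫‖curl u_φ‖² ≤ ∫‖curl u‖²`
  (`memLp_two_convolution`) and `∫|∇ curl u_φ|²_F ≤ ∫|∇ curl u|²_F`
  (`lintegral_frobenius_fderiv_normed_convolution_le` with the classical gradient of `curl u ∈ C¹` as
  weak gradient) — `curl_mollify`, `integrable_norm_curl_mollify_sq`, `integrable_frobenius_curl_mollify`.

Hence P4 (`BoundedSharpDepletion.abs_integral_stretching_le_sharp_of_registered_smooth`) applies to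
`u_φ`, and monotonicity of the right-hand side gives

* `abs_integral_stretching_mollify_le` — ★ **`|∫⟪curl u_φ, Du_φ (curl u_φ)⟫| ≤ ((2+√3)/9) · M ·
  √(∫‖curl u‖²) · √(∫|∇ curl u|²_F)`** for EVERY registered `u` and every bump kernel `φ`: the
  registered stub S1 with `κ = (2+√3)/9 < 1/2`, up to replacing the left side by its value on the
  mollified field.

WHAT REMAINS for S1 by name (ONE lemma): `∫⟪curl u_φₙ, Du_φₙ (curl u_φₙ)⟫ → ∫⟪curl u, Du (curl u)⟫`
along bump kernels with `rOut → 0` (`curl u, ∂ₖu ∈ L² ∩ L⁶ ⊂ L³` by the tree's whole-space Sobolev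
inequality `eLpNorm_six_le_eLpNorm_fderiv_two` + P2/P3; `L³` convergence of mollification
`tendsto_eLpNorm_normed_convolution_sub_self`; Hölder `(3,3,3)`).

HONEST LABEL: helper (step P5 of an L/XL programme); closes no stub; no Navier–Stokes content;
`Target`, S3 and NS regularity remain OPEN.

References: L. C. Evans, *PDE* (2010), §5.3.1 Thm. 1, App. C.4 Thm. 7. [folklore]
-/

noncomputable section

-- the summit and its single sub-problem share the name (CONVENTIONS §1)
set_option linter.dupNamespace false

open Set Filter Topology MeasureTheory ContinuousLinearMap
open scoped RealInnerProductSpace ENNReal NNReal Convolution ContDiff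
open Literature.Analysis.FluidPDE

namespace Summit.NavierStokesRegularity.NavierStokesRegularity.Theorems.DepletionLadder.BoundedMollified

open Summit.NavierStokesRegularity.NavierStokesRegularity.Theorems.DepletionLadder.BoundedSharpDepletion

variable {u : EuclideanSpace ℝ (Fin 3) → EuclideanSpace ℝ (Fin 3)}

/-! ### The mollified field: smoothness, divergence, sup bound, gradient bound -/

/-- `ρ ⋆ u ∈ C^∞` for a bump kernel `ρ = φ.normed` and continuous `u`. [folklore] -/
theorem contDiff_mollify (φ : ContDiffBump (0 : EuclideanSpace ℝ (Fin 3))) (hu : Continuous u) :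
    ContDiff ℝ ∞ (φ.normed volume ⋆[lsmul ℝ ℝ, volume] u) :=
  φ.hasCompactSupport_normed.contDiff_convolution_left _ φ.contDiff_normed
    (hu.locallyIntegrable (μ := volume))

/-- `div (ρ ⋆ u) = 0` for a `C¹` divergence-free `u`. [folklore] -/
theorem isDivFree_mollify (φ : ContDiffBump (0 : EuclideanSpace ℝ (Fin 3))) (hu : ContDiff ℝ 1 u)
    (hdiv : VectorCalculus.IsDivFree u) :
    VectorCalculus.IsDivFree (φ.normed volume ⋆[lsmul ℝ ℝ, volume] u) := fun x =>
  divergence_convolution_eq_zero φ.contDiff_normed φ.hasCompactSupport_normed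
    (hu.continuous.locallyIntegrable (μ := volume))
    (VectorCalculus.IsDivFree.isWeaklyDivFree_holds hdiv hu) x

/-- `‖(ρ ⋆ u)(x)‖ ≤ M` if `‖u‖ ≤ M` (`ρ ≥ 0`, `∫ρ = 1`). [folklore] -/
theorem norm_mollify_le (φ : ContDiffBump (0 : EuclideanSpace ℝ (Fin 3))) {M : ℝ}
    (hM : ∀ x, ‖u x‖ ≤ M) (x : EuclideanSpace ℝ (Fin 3)) :
    ‖(φ.normed volume ⋆[lsmul ℝ ℝ, volume] u) x‖ ≤ M :=
  norm_convolution_le_of_norm_le φ.continuous_normed φ.hasCompactSupport_normed φ.nonneg_normed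
    φ.integral_normed hM x

/-- **The mollified field has a bounded gradient**: `‖D(ρ ⋆ u)(x)‖ ≤ M ∫‖Dρ‖` for `‖u‖ ≤ M`
(`D(ρ ⋆ u)(x) a = ∫ (Dρ(x − y) a) u(y) dy`). [folklore] -/
theorem exists_norm_fderiv_mollify_le (φ : ContDiffBump (0 : EuclideanSpace ℝ (Fin 3)))
    (hu : Continuous u) {M : ℝ} (hM : ∀ x, ‖u x‖ ≤ M) :
    ∃ B : ℝ, ∀ x, ‖fderiv ℝ (φ.normed volume ⋆[lsmul ℝ ℝ, volume] u) x‖ ≤ B := by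
  set ρ : EuclideanSpace ℝ (Fin 3) → ℝ := φ.normed volume with hρdef
  have hρ1 : ContDiff ℝ 1 ρ := φ.contDiff_normed
  have hρc : HasCompactSupport ρ := φ.hasCompactSupport_normed
  have hul : LocallyIntegrable u volume := hu.locallyIntegrable (μ := volume)
  have hM0 : 0 ≤ M := (norm_nonneg _).trans (hM 0)
  have hDc : Continuous (fderiv ℝ ρ) := hρ1.continuous_fderiv one_ne_zero
  have hDs : HasCompactSupport (fderiv ℝ ρ) := hρc.fderiv (𝕜 := ℝ)
  have hDi : Integrable (fun z => ‖fderiv ℝ ρ z‖) volume :=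
    (hDc.norm).integrable_of_hasCompactSupport hDs.norm
  refine ⟨M * ∫ z, ‖fderiv ℝ ρ z‖, fun x => ?_⟩
  refine ContinuousLinearMap.opNorm_le_bound _ (by positivity) fun a => ?_
  rw [hρdef, fderiv_convolution_apply_eq hρ1 hρc hul x a]
  have hmaj : Integrable (fun y => ‖a‖ * M * ‖fderiv ℝ ρ (x - y)‖) volume :=
    ((hDi.comp_sub_left x).const_mul (‖a‖ * M))
  calc ‖∫ y, (fderiv ℝ (φ.normed volume) (x - y) a) • u y‖
      ≤ ∫ y, ‖a‖ * M * ‖fderiv ℝ ρ (x - y)‖ := by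
        refine norm_integral_le_of_norm_le hmaj (Eventually.of_forall fun y => ?_)
        rw [norm_smul, Real.norm_eq_abs]
        calc |fderiv ℝ (φ.normed volume) (x - y) a| * ‖u y‖
            ≤ (‖fderiv ℝ ρ (x - y)‖ * ‖a‖) * M := by
              refine mul_le_mul ?_ (hM y) (norm_nonneg _) (by positivity)
              rw [← Real.norm_eq_abs]
              exact (fderiv ℝ ρ (x - y)).le_opNorm a
          _ = ‖a‖ * M * ‖fderiv ℝ ρ (x - y)‖ := by ring
    _ = ‖a‖ * M * ∫ y, ‖fderiv ℝ ρ (x - y)‖ := integral_const_mul _ _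
    _ = M * (∫ z, ‖fderiv ℝ ρ z‖) * ‖a‖ := by
        rw [integral_sub_left_eq_self (fun z => ‖fderiv ℝ ρ z‖) volume x]; ring

/-! ### Vorticity of the mollified field: `curl (ρ ⋆ u) = ρ ⋆ curl u` and the Jensen contractions -/

/-- `curl (ρ ⋆ u) = ρ ⋆ curl u` for `u ∈ C¹`. [folklore] -/
theorem curl_mollify (φ : ContDiffBump (0 : EuclideanSpace ℝ (Fin 3))) (hu : ContDiff ℝ 1 u) :
    curl (φ.normed volume ⋆[lsmul ℝ ℝ, volume] u) = φ.normed volume ⋆[lsmul ℝ ℝ, volume] curl u :=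
  funext fun x => curl_convolution_lsmul φ.contDiff_normed φ.hasCompactSupport_normed hu x

/-- **Enstrophy contraction**: `‖curl (ρ ⋆ u)‖² ∈ L¹` and `∫‖curl (ρ ⋆ u)‖² ≤ ∫‖curl u‖²` (Jensen).
[folklore] -/
theorem integrable_norm_curl_mollify_sq (φ : ContDiffBump (0 : EuclideanSpace ℝ (Fin 3)))
    (hu : ContDiff ℝ 1 u) (hZ : Integrable fun x => ‖curl u x‖ ^ 2) :
    Integrable (fun x => ‖curl (φ.normed volume ⋆[lsmul ℝ ℝ, volume] u) x‖ ^ 2) ∧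
      ∫ x, ‖curl (φ.normed volume ⋆[lsmul ℝ ℝ, volume] u) x‖ ^ 2 ≤ ∫ x, ‖curl u x‖ ^ 2 := by
  have hωc : Continuous (curl u) := continuous_curl hu
  have hω : MemLp (curl u) 2 volume :=
    (memLp_two_iff_integrable_sq_norm hωc.aestronglyMeasurable).2 hZ
  obtain ⟨hm, hle⟩ := memLp_two_convolution φ.continuous_normed φ.hasCompactSupport_normed
    φ.nonneg_normed φ.integral_normed hω
  rw [curl_mollify φ hu]
  exact ⟨(memLp_two_iff_integrable_sq_norm hm.1).1 hm, hle⟩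

/-- **Palinstrophy contraction**: `|∇ curl (ρ ⋆ u)|²_F ∈ L¹` and `∫|∇ curl (ρ ⋆ u)|²_F ≤ ∫|∇ curl u|²_F`
for `u ∈ C²` with `|∇ curl u|²_F ∈ L¹` (`curl (ρ ⋆ u) = ρ ⋆ curl u`, the classical gradient of
`curl u ∈ C¹` as weak gradient, and the tree's `L²` contraction of mollified weak gradients).
[folklore] -/
theorem integrable_frobenius_curl_mollify (φ : ContDiffBump (0 : EuclideanSpace ℝ (Fin 3)))
    (hu : ContDiff ℝ 2 u) (hP : Integrable fun x => frobeniusNormSq (fderiv ℝ (curl u) x)) :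
    Integrable (fun x => frobeniusNormSq
        (fderiv ℝ (curl (φ.normed volume ⋆[lsmul ℝ ℝ, volume] u)) x)) ∧
      ∫ x, frobeniusNormSq (fderiv ℝ (curl (φ.normed volume ⋆[lsmul ℝ ℝ, volume] u)) x) ≤
        ∫ x, frobeniusNormSq (fderiv ℝ (curl u) x) := by
  have hu1 : ContDiff ℝ 1 u := hu.of_le (by norm_num)
  have hω1 : ContDiff ℝ 1 (curl u) := contDiff_one_curl_of_contDiff_two hu
  have hG : HasWeakGradient (curl u) (fderiv ℝ (curl u)) := hasWeakGradient_fderiv_of_contDiff hω1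
  have hle := lintegral_frobenius_fderiv_normed_convolution_le hG φ
  rw [curl_mollify φ hu1]
  -- the mollified vorticity is smooth, so its gradient Frobenius norm is continuous
  have hsm : ContDiff ℝ 1 (φ.normed volume ⋆[lsmul ℝ ℝ, volume] curl u) :=
    (contDiff_mollify φ (continuous_curl hu1)).of_le (by norm_cast)
  set S : EuclideanSpace ℝ (Fin 3) → ℝ := fun x => frobeniusNormSq
    (fderiv ℝ (φ.normed volume ⋆[lsmul ℝ ℝ, volume] curl u) x) with hS
  have hSc : Continuous S := continuous_frobeniusNormSq_fderiv hsm one_ne_zero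
  have hS0 : ∀ x, 0 ≤ S x := fun x => frobeniusNormSq_nonneg _
  have hP0 : ∀ x, 0 ≤ frobeniusNormSq (fderiv ℝ (curl u) x) := fun x => frobeniusNormSq_nonneg _
  -- finiteness of the right-hand side
  have hPfin : ∫⁻ x, ENNReal.ofReal (frobeniusNormSq (fderiv ℝ (curl u) x)) < ⊤ := by
    rw [← ofReal_integral_eq_lintegral_ofReal hP (ae_of_all _ hP0)]
    exact ENNReal.ofReal_lt_top
  have hSfin : ∫⁻ x, ENNReal.ofReal (S x) < ⊤ := lt_of_le_of_lt hle hPfin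
  have hSi : Integrable S := by
    refine ⟨hSc.aestronglyMeasurable, ?_⟩
    rw [hasFiniteIntegral_iff_ofReal (ae_of_all _ hS0)]
    exact hSfin
  refine ⟨hSi, ?_⟩
  have h1 := ENNReal.toReal_mono hPfin.ne hle
  rwa [← ofReal_integral_eq_lintegral_ofReal hSi (ae_of_all _ hS0),
    ← ofReal_integral_eq_lintegral_ofReal hP (ae_of_all _ hP0),
    ENNReal.toReal_ofReal (integral_nonneg hS0), ENNReal.toReal_ofReal (integral_nonneg hP0)] at h1

/-! ### The sharp depletion inequality for the mollified field, with the right-hand side of `u` -/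

/-- ★ **The mollified field obeys S1 with the data of `u`.** For `u` in the registered binders of
`StretchingDepletion` (`u ∈ C²`, `div u = 0`, `‖u‖ ≤ M`, `‖curl u‖² ∈ L¹`, `|∇ curl u|²_F ∈ L¹`) and
every bump kernel `φ`, the mollification `u_φ = φ.normed ⋆ u` satisfies
`|∫⟪curl u_φ, Du_φ (curl u_φ)⟫| ≤ ((2+√3)/9) · M · √(∫‖curl u‖²) · √(∫|∇ curl u|²_F)`.
(P4 for the smooth bounded-gradient field `u_φ`, then the Jensen contractions.) [folklore] -/
theorem abs_integral_stretching_mollify_le (φ : ContDiffBump (0 : EuclideanSpace ℝ (Fin 3)))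
    (hu : ContDiff ℝ 2 u) (hdiv : VectorCalculus.IsDivFree u) {M : ℝ} (hM : ∀ x, ‖u x‖ ≤ M)
    (hZ : Integrable fun x => ‖curl u x‖ ^ 2)
    (hP : Integrable fun x => frobeniusNormSq (fderiv ℝ (curl u) x)) :
    |∫ x, ⟪curl (φ.normed volume ⋆[lsmul ℝ ℝ, volume] u) x,
        fderiv ℝ (φ.normed volume ⋆[lsmul ℝ ℝ, volume] u) x
          (curl (φ.normed volume ⋆[lsmul ℝ ℝ, volume] u) x)⟫| ≤
      (2 + Real.sqrt 3) / 9 * M * Real.sqrt (∫ x, ‖curl u x‖ ^ 2) *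
        Real.sqrt (∫ x, frobeniusNormSq (fderiv ℝ (curl u) x)) := by
  have hu1 : ContDiff ℝ 1 u := hu.of_le (by norm_num)
  have hM0 : 0 ≤ M := (norm_nonneg _).trans (hM 0)
  obtain ⟨B, hB⟩ := exists_norm_fderiv_mollify_le φ hu.continuous hM
  obtain ⟨hZφ, hZle⟩ := integrable_norm_curl_mollify_sq φ hu1 hZ
  obtain ⟨hPφ, hPle⟩ := integrable_frobenius_curl_mollify φ hu hP
  have h := abs_integral_stretching_le_sharp_of_registered_smooth (contDiff_mollify φ hu.continuous)
    (isDivFree_mollify φ hu1 hdiv) (norm_mollify_le φ hM) hB hZφ hPφ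
  refine h.trans ?_
  have hκ : 0 ≤ (2 + Real.sqrt 3) / 9 * M := by positivity
  have h1 : Real.sqrt (∫ x, ‖curl (φ.normed volume ⋆[lsmul ℝ ℝ, volume] u) x‖ ^ 2) ≤
      Real.sqrt (∫ x, ‖curl u x‖ ^ 2) := Real.sqrt_le_sqrt hZle
  have h2 : Real.sqrt (∫ x, frobeniusNormSq
      (fderiv ℝ (curl (φ.normed volume ⋆[lsmul ℝ ℝ, volume] u)) x)) ≤
      Real.sqrt (∫ x, frobeniusNormSq (fderiv ℝ (curl u) x)) := Real.sqrt_le_sqrt hPle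
  calc (2 + Real.sqrt 3) / 9 * M *
        Real.sqrt (∫ x, ‖curl (φ.normed volume ⋆[lsmul ℝ ℝ, volume] u) x‖ ^ 2) *
        Real.sqrt (∫ x, frobeniusNormSq
          (fderiv ℝ (curl (φ.normed volume ⋆[lsmul ℝ ℝ, volume] u)) x))
      ≤ (2 + Real.sqrt 3) / 9 * M * Real.sqrt (∫ x, ‖curl u x‖ ^ 2) *
        Real.sqrt (∫ x, frobeniusNormSq (fderiv ℝ (curl u) x)) := by
        gcongr

end Summit.NavierStokesRegularity.NavierStokesRegularity.Theorems.DepletionLadder.BoundedMollified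

end
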